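import Mathlib
import Literature.Combinatorics.Additive.TripleProductProperty
import Summits.MatrixMultiplication.MatrixMultiplication.Theorems.SnSubsetDichotomyPolynomialSlackCosetFibring
import Summits.MatrixMultiplication.MatrixMultiplication.Theorems.SnSubsetDichotomyPolynomialSlackCommonValueFibring

/-!
# Hub and cell fibring caps for TPP triples in `S_n`

Crux `Summit.MatrixMultiplication.MatrixMultiplication.Theses.SnSubsetDichotomy.PolynomialSlack`
(item `stmt-MatrixMultiplication-8306`), helper file of lead c6 (line `transport-split-hull`, programme
BEYOND ONE HALF): two further instances of POINT FIBRING over `Stab(v)`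
(`tpp_card_mul_mul_le_pointFibres`: `|S'||T'||U'| ≤ |S'⁻¹v|·|T'⁻¹v|·|U'⁻¹v| · B` for every TPP triple
`(S', T', U')` of `S_n` and every bound `B` on the volumes of TPP triples of `S_{n-1}`), applied to
SUB-TRIPLES of a TPP triple `(S, T, U)` of `S_n` (sub-triples of a TPP triple are TPP,
`TripleProductProperty.mono`):

* `hub_fibring` — for blocks `I, J ⊆ Fin n`, a position `k` and a value `v`:
  `|{s ∈ S : s⁻¹ v ∈ I}|·|{t ∈ T : t⁻¹ v ∈ J}|·|{u ∈ U : u k = v}| ≤ |I|·|J|·B` — the three restricted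
  members have at most `|I|`, `|J|`, `1` distinct `v`-preimages;
* `cell_fibring` — for positions `i, k` and a value `v`:
  `|{s ∈ S : s i = v}|·|T|·|{u ∈ U : u k = v}| ≤ n·B` — the preimage counts are at most `1`, `n`, `1`.

The one-preimage and `n`-preimage counts are `card_image_inv_apply_filter_le_one` and
`card_image_inv_apply_le` of the common-value fibring file; the block count
`card_image_inv_apply_filter_mem_le` is proved here. UNCONDITIONAL (valid for every `n`, including the
degenerate `n = 0`, where all sets of positions are empty).
-/

namespace Summit.MatrixMultiplication.MatrixMultiplication.Theorems.PolynomialSlack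

open scoped BigOperators
open Finset
open Literature.Combinatorics.Additive (TripleProductProperty)

set_option linter.dupNamespace false

/-- A block bump `{x ∈ X : x⁻¹ v ∈ I}` has at most `|I|` distinct `v`-preimages: its image under
`x ↦ x⁻¹ v` lies in `I`. [folklore] -/
theorem card_image_inv_apply_filter_mem_le {n : ℕ} (X : Finset (Equiv.Perm (Fin n)))
    (I : Finset (Fin n)) (v : Fin n) :
    ((X.filter fun x => x⁻¹ v ∈ I).image fun x => x⁻¹ v).card ≤ I.card := by
  refine card_le_card ?_
  intro a ha
  simp only [mem_image, mem_filter] at ha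
  obtain ⟨x, ⟨-, hx⟩, rfl⟩ := ha
  exact hx

/-- **Hub fibring.** If `B` bounds the volume `|S'||T'||U'|` of every TPP triple of `S_{n-1}`, then for
every TPP triple `(S, T, U)` of `S_n`, all blocks `I, J ⊆ Fin n`, every position `k` and every value `v`:
`|{s ∈ S : s⁻¹ v ∈ I}|·|{t ∈ T : t⁻¹ v ∈ J}|·|{u ∈ U : u k = v}| ≤ |I|·|J|·B` — point fibring over
`Stab(v)` (`tpp_card_mul_mul_le_pointFibres`) applied to the sub-triple, whose members have at most
`|I|`, `|J|` and exactly one (`k`) distinct `v`-preimages. [folklore] -/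
theorem hub_fibring {n : ℕ} (B : ℕ)
    (hB : ∀ S' T' U' : Finset (Equiv.Perm (Fin (n - 1))), TripleProductProperty S' T' U' →
      S'.card * T'.card * U'.card ≤ B)
    {S T U : Finset (Equiv.Perm (Fin n))} (h : TripleProductProperty S T U)
    (I J : Finset (Fin n)) (k v : Fin n) :
    (S.filter fun s => s⁻¹ v ∈ I).card * (T.filter fun t => t⁻¹ v ∈ J).card *
        (U.filter fun u => u k = v).card ≤ I.card * J.card * B := by
  have hsub : TripleProductProperty (S.filter fun s => s⁻¹ v ∈ I) (T.filter fun t => t⁻¹ v ∈ J)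
      (U.filter fun u => u k = v) :=
    h.mono (filter_subset _ _) (filter_subset _ _) (filter_subset _ _)
  have hS := card_image_inv_apply_filter_mem_le S I v
  have hT := card_image_inv_apply_filter_mem_le T J v
  have hU := card_image_inv_apply_filter_le_one U k v
  calc (S.filter fun s => s⁻¹ v ∈ I).card * (T.filter fun t => t⁻¹ v ∈ J).card *
        (U.filter fun u => u k = v).card
      ≤ ((S.filter fun s => s⁻¹ v ∈ I).image fun x => x⁻¹ v).card *
          ((T.filter fun t => t⁻¹ v ∈ J).image fun x => x⁻¹ v).card *
          ((U.filter fun u => u k = v).image fun x => x⁻¹ v).card * B :=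
        tpp_card_mul_mul_le_pointFibres v B hB hsub
    _ ≤ I.card * J.card * 1 * B :=
        Nat.mul_le_mul (Nat.mul_le_mul (Nat.mul_le_mul hS hT) hU) le_rfl
    _ = I.card * J.card * B := by ring

/-- **Cell fibring.** If `B` bounds the volume `|S'||T'||U'|` of every TPP triple of `S_{n-1}`, then
for every TPP triple `(S, T, U)` of `S_n`, all positions `i, k` and every value `v`:
`|{s ∈ S : s i = v}|·|T|·|{u ∈ U : u k = v}| ≤ n·B` — point fibring over `Stab(v)`
(`tpp_card_mul_mul_le_pointFibres`) applied to the sub-triple `({s i = v}, T, {u k = v})`, whose outer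
members have a single distinct `v`-preimage (`i`, resp. `k`) while `T` has at most `n`. [folklore] -/
theorem cell_fibring {n : ℕ} (B : ℕ)
    (hB : ∀ S' T' U' : Finset (Equiv.Perm (Fin (n - 1))), TripleProductProperty S' T' U' →
      S'.card * T'.card * U'.card ≤ B)
    {S T U : Finset (Equiv.Perm (Fin n))} (h : TripleProductProperty S T U) (i k v : Fin n) :
    (S.filter fun s => s i = v).card * T.card * (U.filter fun u => u k = v).card ≤ n * B := by
  have hsub : TripleProductProperty (S.filter fun s => s i = v) T (U.filter fun u => u k = v) :=
    h.mono (filter_subset _ _) subset_rfl (filter_subset _ _)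
  have hS := card_image_inv_apply_filter_le_one S i v
  have hT := card_image_inv_apply_le T v
  have hU := card_image_inv_apply_filter_le_one U k v
  calc (S.filter fun s => s i = v).card * T.card * (U.filter fun u => u k = v).card
      ≤ ((S.filter fun s => s i = v).image fun x => x⁻¹ v).card *
          (T.image fun x => x⁻¹ v).card *
          ((U.filter fun u => u k = v).image fun x => x⁻¹ v).card * B :=
        tpp_card_mul_mul_le_pointFibres v B hB hsub
    _ ≤ 1 * n * 1 * B := Nat.mul_le_mul (Nat.mul_le_mul (Nat.mul_le_mul hS hT) hU) le_rfl
    _ = n * B := by ring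

end Summit.MatrixMultiplication.MatrixMultiplication.Theorems.PolynomialSlack
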